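/-
Copyright (c) 2026 the pub-hodgecm-mathlib formalisation cell (harness21).  Prover seat hodgecm-mathlib-K2E2-p12 (g4): Track B «K2-LIT», ENGINE E1,
h413 = stmt-HodgeConjecture-24833; K2E1-plan (g4) DECISION (ii) 2026-09-04T06:48:56Z «AdelicProductIntegral», STAGE 2 (STAGE 1 is ★ `integral_indicator_offBox_prod_eq`).
-/
import Literature.NumberTheory.Automorphic.FiniteAdelePureTensorIntegral   -- ★ Tate 3.3.1 engine `integral_indicator_offBox_prod_eq`, boxes `offBox` ∕ `integralBox`, `countable_heightOneSpectrum`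
import Mathlib.MeasureTheory.Integral.Bochner.Set
import HarnessLib

/-!
# K2·E1 — `AdelicProductIntegral`: THE EULER PRODUCT OF AN INTEGRABLE FACTORIZABLE FUNCTION ON `(𝔸_{K,f})^ι` —
# `∫ ∏_v f_v(x_v) dμ(x) = μ(𝒪̂^ι) · ∏'_v ν_v(𝒪_v^ι)⁻¹ ∫ f_v dν_v` (Tate's Theorem 3.3.1 beyond pure tensors: monotone exhaustion by the boxes `offBox T`)

Track B ∕ K2-LIT, crux h413 = `stmt-HodgeConjecture-24833`, route of record `HCCMUnconditional`; cell `hodgecm-mathlib`, squad K2, ENGINE E1 (campaign «EIS-RANK-ONE»).  Dealer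
K2E1-plan (g4) DECISION (ii) «AdelicProductIntegral» (standalone brick wanted by R7₂ FILE 3 — the Euler product `c(σ) = c_∞(σ)·∏_v c_v(σ)` of the intertwining constant —, by K2Liu
#29s∕#30s and by E3).  THEOREMS ONLY (no `def`, no instance, no notation, no named-fact hypothesis, no `sorry`; default heartbeats); lane `--supports stmt-HodgeConjecture-24833 --as helper`
(count-neutral).  GENERIC: any number field `K`, any finite index type `ι`, any additive Haar measures `μ` on `(𝔸_{K,f})^ι` and `ν_v` on the `K_v^ι`.

STAGE 1 (truncation) is ALREADY ★: `Literature.NumberTheory.Automorphic.integral_indicator_offBox_prod_eq` — for a finset `T` and continuous `F_v : K_v^ι → ℂ`,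
`∫ 𝟙_{offBox T}·∏_{v∈T} F_v(x_v) dμ = μ(𝒪̂^ι) • ∏_{v∈T} ν_v(𝒪_v^ι)⁻¹ • ∫ F_v dν_v` [TateThesis1967 Thm 3.3.1; Guichardet1972 App. D.3].  THIS FILE (STAGE 2) passes to the limit
`T ↑`: the boxes `offBox T = {x : x_v ∈ 𝒪_v^ι ∀ v ∉ T}` increase with `T` and EXHAUST `(𝔸_{K,f})^ι` (every adelic vector is integral off a finite set), so for a FACTORIZABLE function
`F(x) = ∏_v f_v(x_v)` (local factors `f_v` continuous, `f_v = 1` on `𝒪_v^ι` off a finite `S₀`, so the product is finite at every point — a `finprod`) which is `μ`-INTEGRABLE, monotone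
convergence of `∫_{offBox T} F` (Mathlib `tendsto_setIntegral_of_monotone` along the countably generated `atTop` of `Finset (places)`) IS the convergence of the Euler product:
* §1 boxes: `offBox_mono`, `iUnion_offBox = univ`, `exists_finset_mem_offBox`;
* §2 the factorizable function: `finprod_localFactor_eq_prod_of_mem_offBox` (on `offBox T`, `T ⊇ S₀`, the `finprod` is the `T`-product);
* §3 **`setIntegral_offBox_finprod_eq`** (STAGE 1 read for `F`): `∫_{offBox T} F dμ = μ(𝒪̂^ι)·∏_{v∈T} a_v`, `a_v := ν_v(𝒪_v^ι)⁻¹·∫ f_v dν_v`, for every finset `T ⊇ S₀`;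
* §4 MAIN **`hasProd_localIntegral_of_integrable`**: if `F ∈ L¹(μ)` then `HasProd (v ↦ a_v) (μ(𝒪̂^ι)⁻¹·∫ F dμ)` — equivalently **`integral_finprod_eq_mul_tprod`**: `∫ F dμ = μ(𝒪̂^ι)·∏'_v a_v`
  and `Multipliable a`; normalised form `integral_finprod_eq_tprod_of_measure_eq_one` (`μ(𝒪̂^ι) = 1`, `ν_v(𝒪_v^ι) = 1`): **`∫ ∏_v f_v = ∏'_v ∫ f_v`**.
NOT HERE (honest): the converse «bounded partial products ⇒ `F ∈ L¹`» (needs `IntegrableOn F (offBox T)`, which the ★ engine does not export — it would re-open the `evalT` transport of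
★ `CylinderSlices`); consumers bring their own integrability (R7₂ FILE 3: ★ R5a `integrable_intertwiningU_integrand_quasiSplit_two` through the height dictionary).
HONEST LABEL: HC_CM is proved only modulo the 7 printed citations (2 remaining named inputs: hLiu418 = `stmt-HodgeConjecture-24832`, h413 = `stmt-HodgeConjecture-24833`) until rung 0
closes; this file asserts no named fact and closes no socket; count-neutral.

## References
* [TateThesis1967] J. Tate, *Fourier analysis in number fields and Hecke's zeta-functions*, in Cassels–Fröhlich (1967), Ch. XV: §3.3, Thm. 3.3.1, Lemma 3.3.2 (Euler products of factorizable
  integrable functions on restricted products).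
* [Guichardet1972] A. Guichardet, *Symmetric Hilbert Spaces and Related Topics*, LNM 261 (1972): App. D.3 (restricted product measures).
* [WeilBNT1967] A. Weil, *Basic Number Theory* (1967): Ch. IV §1 (adeles), Ch. VII §4 Prop. 10 (Euler products of quasi-factorizable functions).
-/

set_option autoImplicit false
set_option linter.dupNamespace false -- the mandated namespace repeats `HodgeConjecture.HodgeConjecture`

noncomputable section

open scoped RestrictedProduct ENNReal NNReal
open Filter Function Set IsDedekindDomain NumberField MeasureTheory Topology
open Literature.NumberTheory.Automorphic

namespace Summit.HodgeConjecture.HodgeConjecture.Cruxes.H413.AdelicProductIntegral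

section Boxes

variable {K : Type} [Field K] [NumberField K] {ι : Type}

/-! ## §1 The boxes `offBox T` increase with `T` and exhaust `(𝔸_{K,f})^ι` -/

/-- `offBox` is monotone in `T`. [cite: TateThesis1967, §3.3] -/
theorem offBox_mono {T T' : Finset (HeightOneSpectrum (𝓞 K))} (h : T ⊆ T') : offBox (K := K) (ι := ι) T ⊆ offBox T' :=
  fun _ hx i v hv => hx i v fun hvT => hv (h hvT)

/-- `T ↦ offBox T` is a monotone family of sets. [cite: TateThesis1967, §3.3] -/
theorem monotone_offBox : Monotone (offBox (K := K) (ι := ι)) := fun _ _ h => offBox_mono h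

variable [Finite ι]

/-- **Every adelic vector is integral off a finite set of places**: `x ∈ offBox T` for some finset `T`. [cite: TateThesis1967, §3.1–§3.3] -/
theorem exists_finset_mem_offBox (x : ι → FiniteAdeleRing (𝓞 K) K) : ∃ T : Finset (HeightOneSpectrum (𝓞 K)), x ∈ offBox T := by
  have h : ∀ᶠ v in cofinite, ∀ i, x i v ∈ v.adicCompletionIntegers K := eventually_all.mpr fun i => (x i).2
  rw [eventually_cofinite] at h
  exact ⟨h.toFinset, fun i v hv => not_not.mp fun hn => hv (h.mem_toFinset.mpr fun hall => hn (hall i))⟩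

/-- **The boxes exhaust the space**: `⋃_T offBox T = (𝔸_{K,f})^ι`. [cite: TateThesis1967, §3.3] -/
theorem iUnion_offBox : (⋃ T : Finset (HeightOneSpectrum (𝓞 K)), offBox (K := K) (ι := ι) T) = univ :=
  eq_univ_of_forall fun x => mem_iUnion.mpr (exists_finset_mem_offBox x)

end Boxes

/-! ## §2 The factorizable function `F(x) = ∏ᶠ_v f_v(x_v)` -/

section Factorizable

variable {K : Type} [Field K] [NumberField K] {ι : Type}
  (f : ∀ v : HeightOneSpectrum (𝓞 K), (ι → v.adicCompletion K) → ℂ) (S₀ : Finset (HeightOneSpectrum (𝓞 K)))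

/-- **On the box `offBox T` (`T ⊇ S₀`) the Euler product is the finite `T`-product**: `∏ᶠ_v f_v(x_v) = ∏_{v∈T} f_v(x_v)` (off `T` the local factor is `f_v(𝒪_v^ι-point) = 1`).
[cite: TateThesis1967, §3.3] -/
theorem finprod_localFactor_eq_prod_of_mem_offBox (hf1 : ∀ v ∉ S₀, ∀ z ∈ integralBox K ι v, f v z = 1)
    {T : Finset (HeightOneSpectrum (𝓞 K))} (hT : S₀ ⊆ T) {x : ι → FiniteAdeleRing (𝓞 K) K} (hx : x ∈ offBox T) :
    (∏ᶠ v, f v fun i => x i v) = ∏ v ∈ T, f v fun i => x i v := by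
  refine finprod_eq_prod_of_mulSupport_subset _ fun v hv => ?_
  by_contra hvT
  have hvT' : v ∉ T := fun h => hvT (Finset.mem_coe.mpr h)
  exact hv (hf1 v (fun hvS => hvT' (hT hvS)) _ (mem_integralBox_iff.mpr fun i => hx i v hvT'))

end Factorizable

/-! ## §3 STAGE 1 read for `F`: the integral over a box is the finite product of local integrals -/

section Integral

variable (K : Type) [Field K] [NumberField K] (ι : Type) [Finite ι]
  [MeasurableSpace (FiniteAdeleRing (𝓞 K) K)] [BorelSpace (FiniteAdeleRing (𝓞 K) K)]
  [∀ v : HeightOneSpectrum (𝓞 K), MeasurableSpace (v.adicCompletion K)] [∀ v : HeightOneSpectrum (𝓞 K), BorelSpace (v.adicCompletion K)]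
  (μ : Measure (ι → FiniteAdeleRing (𝓞 K) K)) [μ.IsAddHaarMeasure]
  (ν : ∀ v : HeightOneSpectrum (𝓞 K), Measure (ι → v.adicCompletion K)) [∀ v, (ν v).IsAddHaarMeasure]
  (f : ∀ v : HeightOneSpectrum (𝓞 K), (ι → v.adicCompletion K) → ℂ) (S₀ : Finset (HeightOneSpectrum (𝓞 K)))

/-- **`∫_{offBox T} ∏ᶠ_v f_v(x_v) dμ = μ(𝒪̂^ι) · ∏_{v∈T} ν_v(𝒪_v^ι)⁻¹ ∫ f_v dν_v`** for every finset `T ⊇ S₀` (continuous local factors, `= 1` on `𝒪_v^ι` off `S₀`): the ★ engine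
`integral_indicator_offBox_prod_eq` at `F_v := f_v`, after §2 identifies the integrand with `𝟙_{offBox T}·∏_{v∈T} f_v(x_v)`. [cite: TateThesis1967, Thm 3.3.1] [cite: Guichardet1972, App. D.3] -/
theorem setIntegral_offBox_finprod_eq (hcont : ∀ v, Continuous (f v)) (hf1 : ∀ v ∉ S₀, ∀ z ∈ integralBox K ι v, f v z = 1)
    {T : Finset (HeightOneSpectrum (𝓞 K))} (hT : S₀ ⊆ T) :
    ∫ x in offBox T, (∏ᶠ v, f v fun i => x i v) ∂μ =
      (μ (offBox (ι := ι) ∅)).toReal • ∏ v ∈ T, ((ν v (integralBox K ι v)).toReal⁻¹ • ∫ z, f v z ∂ν v) := by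
  haveI : SecondCountableTopology (FiniteAdeleRing (𝓞 K) K) := secondCountableTopology_finiteAdeleRing K
  rw [← integral_indicator (isOpen_offBox T).measurableSet,
    ← integral_indicator_offBox_prod_eq K ι μ ν T f fun v _ => hcont v]
  refine integral_congr_ae (Eventually.of_forall fun x => ?_)
  by_cases hx : x ∈ offBox T
  · rw [indicator_of_mem hx, indicator_of_mem hx, finprod_localFactor_eq_prod_of_mem_offBox f S₀ hf1 hT hx]
  · rw [indicator_of_notMem hx, indicator_of_notMem hx]

/-! ## §4 MAIN: the Euler product of an integrable factorizable function -/

/-- **TATE'S THEOREM 3.3.1 FOR INTEGRABLE FACTORIZABLE FUNCTIONS.**  Let `f_v : K_v^ι → ℂ` be continuous, with `f_v = 1` on `𝒪_v^ι` for `v` off a finite set `S₀`, and suppose the Euler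
product `F(x) = ∏ᶠ_v f_v(x_v)` is `μ`-integrable on `(𝔸_{K,f})^ι`.  Then the local integrals `a_v = ν_v(𝒪_v^ι)⁻¹·∫ f_v dν_v` are MULTIPLIABLE and
`∏'_v a_v = μ(𝒪̂^ι)⁻¹·∫ F dμ` — as a `HasProd`: the partial products over `T` are `μ(𝒪̂^ι)⁻¹·∫_{offBox T} F` (§3) for `T ⊇ S₀`, and these tend to `μ(𝒪̂^ι)⁻¹·∫ F` by monotone
convergence along the boxes (`offBox T ↑ (𝔸_{K,f})^ι`, §1; `atTop` on `Finset (places)` is countably generated as the places are countable, ★ `countable_heightOneSpectrum`).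
[cite: TateThesis1967, Thm 3.3.1, Lemma 3.3.2] [cite: WeilBNT1967, Ch. VII §4 Prop. 10] -/
theorem hasProd_localIntegral_of_integrable (hcont : ∀ v, Continuous (f v)) (hf1 : ∀ v ∉ S₀, ∀ z ∈ integralBox K ι v, f v z = 1)
    (hint : Integrable (fun x : ι → FiniteAdeleRing (𝓞 K) K => ∏ᶠ v, f v fun i => x i v) μ) :
    HasProd (fun v : HeightOneSpectrum (𝓞 K) => (ν v (integralBox K ι v)).toReal⁻¹ • ∫ z, f v z ∂ν v)
      ((μ (offBox (ι := ι) ∅)).toReal⁻¹ • ∫ x, (∏ᶠ v, f v fun i => x i v) ∂μ) := by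
  haveI : Countable (HeightOneSpectrum (𝓞 K)) := countable_heightOneSpectrum K
  haveI : SecondCountableTopology (FiniteAdeleRing (𝓞 K) K) := secondCountableTopology_finiteAdeleRing K
  have hc0 : (μ (offBox (ι := ι) ∅)).toReal ≠ 0 :=
    ENNReal.toReal_ne_zero.mpr ⟨(measure_offBox_empty_pos K ι μ).ne', (measure_offBox_empty_lt_top K ι μ).ne⟩
  -- monotone convergence along the boxes
  have hlim : Tendsto (fun T : Finset (HeightOneSpectrum (𝓞 K)) => ∫ x in offBox T, (∏ᶠ v, f v fun i => x i v) ∂μ) atTop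
      (𝓝 (∫ x, (∏ᶠ v, f v fun i => x i v) ∂μ)) := by
    have h := tendsto_setIntegral_of_monotone (μ := μ) (f := fun x : ι → FiniteAdeleRing (𝓞 K) K => ∏ᶠ v, f v fun i => x i v)
      (fun T => (isOpen_offBox T).measurableSet) monotone_offBox (by rw [iUnion_offBox]; exact hint.integrableOn)
    rwa [iUnion_offBox, setIntegral_univ] at h
  -- the partial products are the (rescaled) box integrals, eventually in `T`
  have hev : ∀ᶠ T : Finset (HeightOneSpectrum (𝓞 K)) in atTop,
      (μ (offBox (ι := ι) ∅)).toReal⁻¹ • ∫ x in offBox T, (∏ᶠ v, f v fun i => x i v) ∂μ =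
        ∏ v ∈ T, ((ν v (integralBox K ι v)).toReal⁻¹ • ∫ z, f v z ∂ν v) := by
    filter_upwards [eventually_ge_atTop S₀] with T hT
    rw [setIntegral_offBox_finprod_eq K ι μ ν f S₀ hcont hf1 hT, ← smul_assoc, smul_eq_mul, inv_mul_cancel₀ hc0, one_smul]
  unfold HasProd
  rw [SummationFilter.unconditional_filter]
  exact (hlim.const_smul ((μ (offBox (ι := ι) ∅)).toReal⁻¹)).congr' hev

/-- **`∫ ∏_v f_v dμ = μ(𝒪̂^ι) · ∏'_v ν_v(𝒪_v^ι)⁻¹ ∫ f_v dν_v`, and the Euler product converges** (`Multipliable`), under the hypotheses of `hasProd_localIntegral_of_integrable`.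
[cite: TateThesis1967, Thm 3.3.1] -/
theorem integral_finprod_eq_mul_tprod (hcont : ∀ v, Continuous (f v)) (hf1 : ∀ v ∉ S₀, ∀ z ∈ integralBox K ι v, f v z = 1)
    (hint : Integrable (fun x : ι → FiniteAdeleRing (𝓞 K) K => ∏ᶠ v, f v fun i => x i v) μ) :
    Multipliable (fun v : HeightOneSpectrum (𝓞 K) => (ν v (integralBox K ι v)).toReal⁻¹ • ∫ z, f v z ∂ν v) ∧
    ∫ x, (∏ᶠ v, f v fun i => x i v) ∂μ =
      (μ (offBox (ι := ι) ∅)).toReal • ∏' v : HeightOneSpectrum (𝓞 K), ((ν v (integralBox K ι v)).toReal⁻¹ • ∫ z, f v z ∂ν v) := by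
  have h := hasProd_localIntegral_of_integrable K ι μ ν f S₀ hcont hf1 hint
  have hc0 : (μ (offBox (ι := ι) ∅)).toReal ≠ 0 :=
    ENNReal.toReal_ne_zero.mpr ⟨(measure_offBox_empty_pos K ι μ).ne', (measure_offBox_empty_lt_top K ι μ).ne⟩
  refine ⟨h.multipliable, ?_⟩
  rw [h.tprod_eq, ← smul_assoc, smul_eq_mul, mul_inv_cancel₀ hc0, one_smul]

/-- **Normalised form: `∫ ∏_v f_v = ∏'_v ∫ f_v`** when `μ(𝒪̂^ι) = 1` and `ν_v(𝒪_v^ι) = 1` for all `v` (Tate's normalisation of the restricted product measure).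
[cite: TateThesis1967, §3.3, Thm 3.3.1] -/
theorem integral_finprod_eq_tprod_of_measure_eq_one (hμ : μ (offBox (ι := ι) ∅) = 1) (hν : ∀ v, ν v (integralBox K ι v) = 1)
    (hcont : ∀ v, Continuous (f v)) (hf1 : ∀ v ∉ S₀, ∀ z ∈ integralBox K ι v, f v z = 1)
    (hint : Integrable (fun x : ι → FiniteAdeleRing (𝓞 K) K => ∏ᶠ v, f v fun i => x i v) μ) :
    HasProd (fun v : HeightOneSpectrum (𝓞 K) => ∫ z, f v z ∂ν v) (∫ x, (∏ᶠ v, f v fun i => x i v) ∂μ) := by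
  have h := hasProd_localIntegral_of_integrable K ι μ ν f S₀ hcont hf1 hint
  simp only [hμ, hν, ENNReal.toReal_one, inv_one, one_smul] at h
  exact h

end Integral

end Summit.HodgeConjecture.HodgeConjecture.Cruxes.H413.AdelicProductIntegral

end
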